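import Summits.QuantumFields.BalabanUV.T4Continuum.Support.NE7NestedExtNearFlat
import Summits.QuantumFields.BalabanUV.T4Continuum.Support.NE7CurvedSupLetterPrep
import Summits.QuantumFields.BalabanUV.T4Continuum.Support.NE7FlatCurvedPointwise
import Summits.QuantumFields.BalabanUV.T4Continuum.Support.NE7EnergySliceDivergenceSup
import Summits.QuantumFields.BalabanUV.T4Continuum.Spine.NE3.SlicePoincareSlicB8Gauge
import HarnessLib

/-!
# NE7CurvedSupLetterDiv — THE DIVERGENCE DATUM OF THE CUT-OFF GAUGED SLICE ELEMENT: for `Y ∈ 𝒯_E(W)` (so `covDiv W Y = nestedExt g`, `‖g‖, ‖covDiv W Y‖ ≤ G = O(S∕M)`), the comb gauge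
# `u` and a sup-step `g₁`-Lipschitz cut-off `χ`, the flat divergence of `Z = χ•Y^u` is within
# `d·g₁·S + |χ x|·(2dδ·S + 4d(L−1)σ·G) + (M−1)g₁·G` of the FLAT block constant `b ↦ χ(M•b)•Ad_{u(M•b)}(covDiv W Y (M•b))` (`σ = Σ_{i≤k}(L^iδ + 2loopRad(x_i))`, `δ` the
# near-flatness of `W^u` at `x` and on the fine ball of `x`'s block — asked only where `χ x ≠ 0`)

Cell `pub-balaban`, rung (B)+1 sub-cell t4, lineage `b2b-balaban-t4-ne7-p1`, generation 101 (CRUX PROVER NE7 #1 = OWNER of BINDER row NE7).  Memo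
`t4/b2b-balaban-t4-ne7-p1-g101/ROAD-G101.md` §5: the divergence input `D` of `NE7FlatSupLetterCompact.sup_flat_compact` in the bootstrap for THE CURVED SUP LETTER (L).  The four
terms: (1) the cut-off commutator (`NE7CutoffLeibniz.norm_flatDiv_smul_fun_sub_le`); (2) flat vs covariant divergence at the near-flat `W^u` (`NE7FlatCurvedPointwise.norm_covDiv_sub_flatDiv_le`);
(3) the within-block oscillation of `f = covDiv (W^u) (Y^u) = Ad_u (covDiv W Y)` (`Spine/NE3/SlicePoincareSlicB8Gauge.covDiv_gaugeAct`) `= nestedExt_{W^u}(Ad_{u(M•·)} g)`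
(`NE7NestedExtNearFlat.nestedExt_gaugeAct`), bounded by `NE7NestedExtNearFlat.norm_nestedExt_sub_le_sum` over row NE3's closed near-identity tower
(`NE3QbarIterCovLiftPrep.norm_cavgIter_sub_one_le_closed`) on the fine ball of the block; (4) the variation of `χ` from `x` to the block corner (`NE7LocalStraightDatumLetter.abs_sub_le_mul_of_supStep`).
WHAT ([folklore]; 0 def, 0 sorry; every `d ≥ 1`, `L ≥ 2`, multi-level small-field class at `W`).  §1 geometry: `blk_pow_blk`, `pow_le_sum_pow`, `corner_le_of_dvd`, `box_l1_le` (the level-`i` comb box above `x`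
lies in the fine ball of `x`'s `M`-block, radius `nbRad·Σ_{i<m}L^i`).  §2 **`div_datum`**.
HONEST FRAMING (page 1): bookkeeping BY NAME; nothing of Bałaban's asserted; THE CURVED LETTER (L) IS NOT PROVED HERE; NOT (S1), NOT NE7; spine 0∕9; finite T⁴ rung (B)+1 — NOT infinite volume,
NOT mass gap, NOT BetaPertH, NOT Clay.  Continuum YM on T⁴ ⇐ BetaPertH ∧ nine spine estimates (0/9 proved); BetaPertH ⇐ (D1) ∧ (D4) ∧ CAP+tail; G-an2-4 gates asym, D1 and NE2/3/4.
-/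

set_option autoImplicit false

open scoped BigOperators Matrix.Norms.L2Operator
open Finset

namespace Summit.QuantumFields.BalabanUV.T4Continuum.NE7CurvedSupLetterDiv

open Literature.MathematicalPhysics.QuantumFieldTheory.Balaban1983to89
open B7Prop1Explicit B7Prop2Explicit
open T4AveragingDeficitWall (IsUnitaryCfg SmallField Ad)
open AveragingDeficitTransport (norm_Ad_of_unitary)
open AveragingDeficitMultiLevelPrep (cavgIter LevelSmall)
open AveragingDeficitTwoLevelPrep (prop1Radius)
open AveragingDeficitLocality (dirGauge)
open SpreadLift (loopRad)
open BlockAverageVaryHolo (nbRad)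
open NE3CoercivityScaling (flatDiv)
open NE3CovariantWeitzenbock (covDiv)
open NE3QbarIterCovLiftPrep (norm_cavgIter_sub_one_le_closed)
open NE3.SlicePoincareSlicB8Gauge (covDiv_gaugeAct)
open SpreadLiftDirection (isUnitaryCfg_gaugeAct')
open BlockAverageCurrent (smallField_gaugeAct)
open SmoothRefineBlocks (blk res blk_add_res res_nonneg res_le blk_res_smul)
open NE7CutoffLeibniz (norm_flatDiv_smul_fun_sub_le)
open NE7FlatCurvedPointwise (norm_covDiv_sub_flatDiv_le)
open NE7NestedCovariantExtension (nestedExt nestedExt_corner)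
open NE7NestedExtNearFlat (nestedExt_gaugeAct norm_nestedExt_sub_le_sum)
open NE7EnergySliceSupFlatSite (blk_blk)
open NE7LocalStraightDatumLetter (norm_dirGauge_le abs_sub_le_mul_of_supStep)

noncomputable section

variable {d : ℕ} {n : Type*} [Fintype n] [DecidableEq n]

/-! ## §1 Geometry: the comb boxes above a point lie in the fine balls of its block -/

omit [Fintype n] [DecidableEq n] in
/-- `blk_{L^a} ∘ blk_{L^b} = blk_{L^{b+a}}`. [folklore] -/
theorem blk_pow_blk (L a : ℕ) : ∀ (b : ℕ) (x : Site d), blk (L ^ a) (blk (L ^ b) x) = blk (L ^ (b + a)) x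
  | 0, x => by
      have h1 : blk 1 x = x := by funext i; simp [blk]
      rw [pow_zero, h1, zero_add]
  | b + 1, x => by
      rw [← blk_blk L b x, blk_pow_blk L a b (blk L x), blk_blk, show b + a + 1 = b + 1 + a by ring]

omit [Fintype n] [DecidableEq n] in
/-- `L^{m−1} ≤ Σ_{i<m} L^i` for `m ≥ 1`. [folklore] -/
theorem pow_le_sum_pow (L : ℕ) {m : ℕ} (hm : 1 ≤ m) : L ^ (m - 1) ≤ ∑ i ∈ Finset.range m, L ^ i := by
  have hmem : m - 1 ∈ Finset.range m := Finset.mem_range.mpr (by omega)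
  exact Finset.single_le_sum (f := fun i => L ^ i) (fun i _ => Nat.zero_le _) hmem

omit [Fintype n] [DecidableEq n] in
/-- coarser block corners are lower: for `P = L·Q` (`L ≥ 1`, `Q ≥ 1`) and any integer `a`, `P·(a ∕ P) ≤ L·(a ∕ L)`. [folklore] -/
theorem corner_le_of_dvd {L Q : ℕ} (hL : 1 ≤ L) (hQ : 1 ≤ Q) (a : ℤ) : ((L * Q : ℕ) : ℤ) * (a / ((L * Q : ℕ) : ℤ)) ≤ (L : ℤ) * (a / (L : ℤ)) := by
  have hL0 : (0 : ℤ) < L := by exact_mod_cast (by omega : 0 < L)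
  have hP0 : (0 : ℤ) < ((L * Q : ℕ) : ℤ) := by exact_mod_cast (Nat.mul_pos (by omega) (by omega) : 0 < L * Q)
  -- `P·(a/P) ≤ a`, and it is a multiple of `L`, hence `≤ L·(a/L)`
  have h1 : ((L * Q : ℕ) : ℤ) * (a / ((L * Q : ℕ) : ℤ)) ≤ a := Int.mul_ediv_self_le (ne_of_gt hP0)
  have h2 : ((L * Q : ℕ) : ℤ) * (a / ((L * Q : ℕ) : ℤ)) = (L : ℤ) * ((Q : ℤ) * (a / ((L * Q : ℕ) : ℤ))) := by push_cast; ring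
  rw [h2] at h1 ⊢
  have h3 : (Q : ℤ) * (a / ((L * Q : ℕ) : ℤ)) ≤ a / (L : ℤ) := by
    rw [Int.le_ediv_iff_mul_le hL0, mul_comm]
    exact h1
  exact mul_le_mul_of_nonneg_left h3 hL0.le

omit [Fintype n] [DecidableEq n] in
/-- **THE COMB BOX ABOVE A POINT LIES IN THE FINE BALL OF ITS BLOCK**: for `i + m = k+1`, `m ≥ 1`, `L ≥ 1` and `w` with `L•blk_L(x_i) ≤ w ≤ x_i` (`x_i = blk_{L^i} x`), the `ℓ¹`
distance of `w` from `L^m•blk_{L^{k+1}} x` is `≤ d(L^m − 1) ≤ nbRad·Σ_{i′<m}L^{i′}`. [folklore] -/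
theorem box_l1_le {L : ℕ} (hL : 1 ≤ L) {k i m : ℕ} (him : i + m = k + 1) (hm : 1 ≤ m) (x w : Site d)
    (hlo : (L : ℤ) • blk L (blk (L ^ i) x) ≤ w) (hhi : w ≤ blk (L ^ i) x) :
    l1 (w - ((L : ℤ) ^ m) • blk (L ^ (k + 1)) x) ≤ nbRad d L * ∑ i' ∈ Finset.range m, L ^ i' := by
  have hLm1 : 1 ≤ L ^ m := Nat.one_le_pow _ _ hL
  set xi := blk (L ^ i) x with hxi
  have hb : blk (L ^ (k + 1)) x = blk (L ^ m) xi := by rw [hxi, blk_pow_blk, him]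
  -- coordinatewise `0 ≤ w − L^m•blk ≤ L^m − 1`
  have hv0 : ∀ j, 0 ≤ (w - ((L : ℤ) ^ m) • blk (L ^ (k + 1)) x) j := by
    intro j
    have h1 : ((L ^ m : ℕ) : ℤ) * (xi j / ((L ^ m : ℕ) : ℤ)) ≤ (L : ℤ) * (xi j / (L : ℤ)) := by
      obtain ⟨m', rfl⟩ : ∃ m', m = m' + 1 := ⟨m - 1, by omega⟩
      have := corner_le_of_dvd (Q := L ^ m') hL (Nat.one_le_pow _ _ hL) (xi j)
      have e : L ^ (m' + 1) = L * L ^ m' := pow_succ' L m'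
      rw [e]; exact this
    have h2 := hlo j
    simp only [Pi.smul_apply, smul_eq_mul, blk] at h2
    simp only [Pi.sub_apply, Pi.smul_apply, smul_eq_mul, hb, blk]
    push_cast at h1 ⊢
    linarith
  have hv1 : ∀ j, (w - ((L : ℤ) ^ m) • blk (L ^ (k + 1)) x) j ≤ ((L ^ m : ℕ) : ℤ) - 1 := by
    intro j
    have h3 := hhi j
    have h4 := congr_fun (blk_add_res (L ^ m) xi) j
    have h5 := res_le hLm1 xi j
    simp only [Pi.add_apply, Pi.smul_apply, smul_eq_mul] at h4
    simp only [Pi.sub_apply, Pi.smul_apply, smul_eq_mul, hb]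
    push_cast at h4 h5 ⊢
    linarith
  -- `l1 ≤ d (L^m − 1) ≤ nbRad · L^{m−1} ≤ nbRad · Σ`
  have hl1 : l1 (w - ((L : ℤ) ^ m) • blk (L ^ (k + 1)) x) ≤ d * (L ^ m - 1) := by
    unfold l1
    calc ∑ κ, ((w - ((L : ℤ) ^ m) • blk (L ^ (k + 1)) x) κ).natAbs ≤ ∑ _κ : Fin d, (L ^ m - 1) :=
          Finset.sum_le_sum fun κ _ => by
            have a0 := hv0 κ; have a1 := hv1 κ
            have : (((w - ((L : ℤ) ^ m) • blk (L ^ (k + 1)) x) κ).natAbs : ℤ) ≤ ((L ^ m : ℕ) : ℤ) - 1 := by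
              rw [Int.natAbs_of_nonneg a0]; exact a1
            omega
      _ = d * (L ^ m - 1) := by rw [Finset.sum_const, Finset.card_univ, Fintype.card_fin, smul_eq_mul]
  refine hl1.trans ?_
  have hsum := pow_le_sum_pow L hm
  have hnb : d * (L ^ m - 1) ≤ nbRad d L * L ^ (m - 1) := by
    obtain ⟨m', rfl⟩ : ∃ m', m = m' + 1 := ⟨m - 1, by omega⟩
    simp only [Nat.add_sub_cancel, nbRad]
    have e : L ^ (m' + 1) = L * L ^ m' := by ring
    rw [e]
    calc d * (L * L ^ m' - 1) ≤ d * (L * L ^ m') := Nat.mul_le_mul_left _ (Nat.sub_le _ _)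
      _ ≤ (2 * (d * L) + 2 * L) * L ^ m' := by nlinarith [Nat.zero_le (d * (L * L ^ m')), Nat.zero_le (L * L ^ m')]
  exact hnb.trans (Nat.mul_le_mul_left _ hsum)

/-! ## §2 The divergence datum -/

/-- **THE DIVERGENCE DATUM OF `Z = χ•Y^u`** (multi-level small-field class at the unitary `W`, `L ≥ 2`, `d ≥ 1`, unitary `u`, `M = L^{k+1}`): with `f := Ad_u (covDiv W Y)`, the local form
`covDiv W Y = nestedExt g`, `‖g‖, ‖covDiv W Y‖ ≤ G`, `‖Y‖ ≤ S`, `χ` `g₁`-Lipschitz per sup-unit step, `σ = Σ_{i<k+1}(L^iδ + 2loopRad(x_i))` with `2d(L−1)σ ≤ 1∕2`, and — ONLY WHERE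
`χ x ≠ 0` — `‖W^u(x,·) − 1‖ ≤ δ` and `‖W^u − 1‖ ≤ δ` on the fine ball of the block of `x`:
`‖flatDiv (χ•Y^u) x − χ(M•b)•f(M•b)‖ ≤ d·g₁·S + |χ x|·(d·(2δS) + 4d(L−1)σ·G) + (M−1)·g₁·G`, `b = blk_M x`. [folklore] -/
theorem div_datum [Nonempty n] (hd : 1 ≤ d) {L : ℕ} (hL : 2 ≤ L) (k : ℕ) {W : Site d → Fin d → (Matrix n n ℂ)ˣ} {x : ℝ}
    (hWu : IsUnitaryCfg W) (hx : 0 ≤ x) (hs : LevelSmall d L k x) (hWx : SmallField W x)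
    {u : Site d → (Matrix n n ℂ)ˣ} (hu : ∀ y, u y ∈ unitaryUnits (Matrix n n ℂ))
    (Y : Site d → Fin d → Matrix n n ℂ) {g : Site d → Matrix n n ℂ} (hloc : ∀ y, covDiv W Y y = nestedExt L (k + 1) W g y)
    {S G g₁ δ : ℝ} (hS : ∀ y μ, ‖Y y μ‖ ≤ S) (hG : ∀ b, ‖g b‖ ≤ G) (hGc : ∀ y, ‖covDiv W Y y‖ ≤ G) (hg₁ : 0 ≤ g₁) (hδ0 : 0 ≤ δ)
    (χ : Site d → ℝ) (hstep : ∀ x₁ x₂ : Site d, (∀ j, |x₂ j - x₁ j| ≤ 1) → |χ x₂ - χ x₁| ≤ g₁)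
    (hσ : 2 * ((d : ℝ) * ((L : ℝ) - 1)) * ∑ i ∈ Finset.range (k + 1), ((L : ℝ) ^ i * δ + 2 * loopRad d L ((prop1Radius d L)^[i] x)) ≤ 1 / 2)
    (xpt : Site d)
    (hWq : χ xpt ≠ 0 → ∀ μ, ‖((gaugeAct u W xpt μ : (Matrix n n ℂ)ˣ) : Matrix n n ℂ) - 1‖ ≤ δ)
    (hball : χ xpt ≠ 0 → ∀ (x' : Site d) (μ : Fin d), l1 (x' - ((L : ℤ) ^ (k + 1)) • blk (L ^ (k + 1)) xpt) ≤ nbRad d L * ∑ i ∈ Finset.range (k + 1), L ^ i →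
      ‖((gaugeAct u W x' μ : (Matrix n n ℂ)ˣ) : Matrix n n ℂ) - 1‖ ≤ δ) :
    ‖flatDiv (fun y μ => χ y • dirGauge u Y y μ) xpt
        - (fun b : Site d => χ (((L ^ (k + 1) : ℕ) : ℤ) • b) • Ad (u (((L ^ (k + 1) : ℕ) : ℤ) • b)) (covDiv W Y (((L ^ (k + 1) : ℕ) : ℤ) • b))) (blk (L ^ (k + 1)) xpt)‖
      ≤ d * g₁ * S + |χ xpt| * (d * (2 * δ * S) + 4 * ((d : ℝ) * ((L : ℝ) - 1)) * (∑ i ∈ Finset.range (k + 1), ((L : ℝ) ^ i * δ + 2 * loopRad d L ((prop1Radius d L)^[i] x))) * G)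
        + (((L ^ (k + 1) - 1 : ℕ)) : ℝ) * g₁ * G := by
  have hL1 : 1 ≤ L := by omega
  have hM1 : 1 ≤ L ^ (k + 1) := Nat.one_le_pow _ _ hL1
  have hW'u : IsUnitaryCfg (gaugeAct u W) := isUnitaryCfg_gaugeAct' hu hWu
  have hW'x : SmallField (gaugeAct u W) x := smallField_gaugeAct hu hWx
  have hS0 : 0 ≤ S := (norm_nonneg _).trans (hS 0 ⟨0, hd⟩)
  have hG0 : 0 ≤ G := (norm_nonneg _).trans (hG 0)
  have hMz : ((L ^ (k + 1) : ℕ) : ℤ) = (L : ℤ) ^ (k + 1) := by push_cast; ring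
  set q : Site d := ((L ^ (k + 1) : ℕ) : ℤ) • blk (L ^ (k + 1)) xpt with hq
  set Y' := dirGauge u Y with hY'
  set f : Site d → Matrix n n ℂ := fun y => Ad (u y) (covDiv W Y y) with hf
  have hY'eq : Y' = fun y μ => Ad (u (y + e μ)) (Y y μ) := rfl
  have hS' : ∀ y μ, ‖Y' y μ‖ ≤ S := fun y μ => by rw [hY'eq]; exact norm_dirGauge_le hu Y hS y μ
  have hfq : ‖f q‖ ≤ G := by simp only [hf]; rw [norm_Ad_of_unitary (hu _)]; exact hGc _
  -- (1) the cut-off commutator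
  have h1 : ‖flatDiv (fun y μ => χ y • Y' y μ) xpt - χ xpt • flatDiv Y' xpt‖ ≤ d * g₁ * S :=
    norm_flatDiv_smul_fun_sub_le χ Y' xpt (fun μ =>
      hstep (xpt - e μ) xpt (fun j => by simp only [Pi.sub_apply, e_apply]; split_ifs <;> simp)) (fun μ => hS' _ _)
  -- (2) flat vs covariant divergence (only where `χ xpt ≠ 0`)
  have hfcov : covDiv (gaugeAct u W) Y' xpt = f xpt := covDiv_gaugeAct u W Y xpt
  have h2 : ‖χ xpt • (flatDiv Y' xpt - f xpt)‖ ≤ |χ xpt| * (d * (2 * δ * S)) := by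
    by_cases hχ : χ xpt = 0
    · rw [hχ, zero_smul, norm_zero, abs_zero, zero_mul]
    · rw [norm_smul, Real.norm_eq_abs, ← hfcov, ← norm_neg, neg_sub]
      exact mul_le_mul_of_nonneg_left (norm_covDiv_sub_flatDiv_le hW'u Y' xpt (hWq hχ) (fun μ => hS' _ _)) (abs_nonneg _)
  -- (3) the within-block oscillation of `f` (only where `χ xpt ≠ 0`)
  have h3 : ‖χ xpt • (f xpt - f q)‖
      ≤ |χ xpt| * (4 * ((d : ℝ) * ((L : ℝ) - 1)) * (∑ i ∈ Finset.range (k + 1), ((L : ℝ) ^ i * δ + 2 * loopRad d L ((prop1Radius d L)^[i] x))) * G) := by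
    by_cases hχ : χ xpt = 0
    · rw [hχ, zero_smul, norm_zero, abs_zero, zero_mul]
    rw [norm_smul, Real.norm_eq_abs]
    refine mul_le_mul_of_nonneg_left ?_ (abs_nonneg _)
    -- `f = nestedExt_{W^u} g′`
    set g' : Site d → Matrix n n ℂ := fun z => Ad (u (((L ^ (k + 1) : ℕ) : ℤ) • z)) (g z) with hg'
    have hfx : f xpt = nestedExt L (k + 1) (gaugeAct u W) g' xpt := by
      rw [hg', nestedExt_gaugeAct hL1 k hWu hx hs hWx hu g xpt]
      simp only [hf]
      rw [hloc]
    have hfq' : f q = g' (blk (L ^ (k + 1)) xpt) := by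
      have hc := nestedExt_corner hL1 (k + 1) W g (blk (L ^ (k + 1)) xpt)
      rw [← hMz] at hc
      simp only [hf, hg', hq]
      rw [hloc, hc]
    rw [hfx, hfq']
    have hbox := fun (i : ℕ) (hi : i ≤ k) (w : Site d) (ν : Fin d) (h1' : (L : ℤ) • blk L (blk (L ^ i) xpt) ≤ w) (h2' : w + e ν ≤ blk (L ^ i) xpt) =>
      norm_cavgIter_sub_one_le_closed hL hW'u hx hs hW'x (blk (L ^ (k + 1)) xpt) (hball hχ) i (k + 1 - i) (by omega) w ν
        (box_l1_le hL1 (by omega) (by omega) xpt w h1' (fun j => by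
          have := h2' j; simp only [Pi.add_apply, e_apply] at this; split_ifs at this <;> linarith))
    have hmain := norm_nestedExt_sub_le_sum hL1 k hW'u hx hs hW'x g' xpt
      (δ := fun i => (L : ℝ) ^ i * δ + 2 * loopRad d L ((prop1Radius d L)^[i] x))
      (fun i => by have := NE3CovariantLineSumsError.iterate_prop1Radius_nonneg (d := d) (L := L) i hx; have hl : 0 ≤ loopRad d L ((prop1Radius d L)^[i] x) := by unfold loopRad; positivity
                   positivity) hbox hσ
    refine hmain.trans (mul_le_mul_of_nonneg_left ?_ (by
      have : 0 ≤ ∑ i ∈ Finset.range (k + 1), ((L : ℝ) ^ i * δ + 2 * loopRad d L ((prop1Radius d L)^[i] x)) :=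
        Finset.sum_nonneg fun i _ => by
          have := NE3CovariantLineSumsError.iterate_prop1Radius_nonneg (d := d) (L := L) i hx
          have hl : 0 ≤ loopRad d L ((prop1Radius d L)^[i] x) := by unfold loopRad; positivity
          positivity
      have h4 : 0 ≤ 4 * ((d : ℝ) * ((L : ℝ) - 1)) := by
        have : (1 : ℝ) ≤ L := by exact_mod_cast hL1
        have : 0 ≤ (L : ℝ) - 1 := by linarith
        positivity
      positivity))
    rw [hg']; dsimp only; rw [norm_Ad_of_unitary (hu _)]; exact hG _
  -- (4) the variation of `χ` from `xpt` to the corner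
  have h4 : ‖(χ xpt - χ q) • f q‖ ≤ (((L ^ (k + 1) - 1 : ℕ)) : ℝ) * g₁ * G := by
    rw [norm_smul, Real.norm_eq_abs]
    have hdist : ∀ j, |xpt j - q j| ≤ ((L ^ (k + 1) - 1 : ℕ) : ℤ) := fun j => by
      have h := congr_fun (blk_add_res (L ^ (k + 1)) xpt) j
      simp only [Pi.add_apply, Pi.smul_apply, smul_eq_mul] at h
      have h0 := res_nonneg hM1 xpt j
      have h1' := res_le hM1 xpt j
      have hc : ((L ^ (k + 1) - 1 : ℕ) : ℤ) = ((L ^ (k + 1) : ℕ) : ℤ) - 1 := by push_cast [Nat.cast_sub hM1]; ring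
      simp only [hq, Pi.smul_apply, smul_eq_mul]
      rw [hc, abs_le]; constructor <;> linarith
    have hχv := abs_sub_le_mul_of_supStep χ hstep (L ^ (k + 1) - 1) xpt q hdist
    exact mul_le_mul hχv hfq (norm_nonneg _) (by positivity)
  -- sum
  have e : flatDiv (fun y μ => χ y • Y' y μ) xpt - χ q • f q
      = (flatDiv (fun y μ => χ y • Y' y μ) xpt - χ xpt • flatDiv Y' xpt) + χ xpt • (flatDiv Y' xpt - f xpt) + χ xpt • (f xpt - f q) + (χ xpt - χ q) • f q := by
    simp only [smul_sub, sub_smul]; abel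
  show ‖flatDiv (fun y μ => χ y • Y' y μ) xpt - χ q • f q‖ ≤ _
  rw [e]
  calc _ ≤ ‖flatDiv (fun y μ => χ y • Y' y μ) xpt - χ xpt • flatDiv Y' xpt‖ + ‖χ xpt • (flatDiv Y' xpt - f xpt)‖ + ‖χ xpt • (f xpt - f q)‖ + ‖(χ xpt - χ q) • f q‖ := by
        refine (norm_add_le _ _).trans (add_le_add ((norm_add_le _ _).trans (add_le_add (norm_add_le _ _) le_rfl)) le_rfl)
    _ ≤ _ := by linarith [h1, h2, h3, h4]

end

end Summit.QuantumFields.BalabanUV.T4Continuum.NE7CurvedSupLetterDiv
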